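import Literature.NumberTheory.Sieve.MaynardSmallK
import Literature.NumberTheory.Sieve.FordMaynardPrimeSumsSlices
import HarnessLib

/-!
# Product test functions for the Maynard functional (Polymath 8b, §6, proof of Theorem 6.7)

D.H.J. Polymath, *Variants of the Selberg sieve, and bounded intervals containing many primes*,
Res. Math. Sci. 1 (2014), Art. 12 = arXiv:1407.4897v4, §6, proof of Theorem 6.7 (the
displays between the definition of `F` and the inequality labelled `(rg1)` in the arXiv source,
`E(∫_{[0,r−S_{k−1}]} g)² ≤ (m₂ M_k^{[T]} r/k) P(S_k ≤ r)`). For a one-variable profile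
`g : [0, ∞) → ℝ` Polymath take the symmetric product test function

  `F(t₁, …, t_k) := 1_{t₁ + ⋯ + t_k ≤ 1} · g(t₁) ⋯ g(t_k)`                (here `r = 1`)

and record (verbatim, with `m₂ = ∫ g²` and `X₁, …, X_k` i.i.d. of density `g²/m₂`):

* `I(F) = m₂^k ∫₀^∞ ⋯ ∫₀^∞ 1_{t₁+⋯+t_k ≤ r} ∏ g(tᵢ)² dtᵢ/m₂ = m₂^k P(X₁ + ⋯ + X_k ≤ r)`;
* `J_k(F) = m₂^{k−1} ∫₀^∞ ⋯ ∫₀^∞ (∫_{[0, r − t₁ − ⋯ − t_{k−1}]} g(t) dt)² ∏_{i<k} g(tᵢ)² dtᵢ/m₂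
          = m₂^{k−1} E (∫_{[0, r − S_{k−1}]} g(t) dt)²`;
* "by symmetry we see that `J_i(F) = J_k(F)` for all `i = 1, …, k`".

This file PROVES these identities for the tree's `maynardI`, `maynardJ`, `maynardFunctional`
(`Literature/NumberTheory/Sieve/MaynardTao.lean`), with the law of `S_j = X₁ + ⋯ + X_j` written
out as what it is — the `j`-fold one-sided convolution power `(g²)^{⋆j}`
(`Literature.Analysis.Convolution.cpow`): for `k ≥ 2` and locally bounded measurable `g`,

  `I(F) = ∫_{(0,1]} (g²)^{⋆k}(w) dw`,
  `J^{(m)}(F) = ∫_{(0,1]} (∫₀^{1−w} g)² (g²)^{⋆(k−1)}(w) dw`   (every `m`),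
  `M-functional(F) = k · J / I`                                   (`maynardFunctional_productTestFn`),

so that a lower bound for `M_k` from this family is a statement about two one-dimensional
convolution integrals (this is how Polymath evaluate the family in the proof of Theorem 6.7, and how
certified evaluations of it are organised). Also: the family is Maynard-admissible
(`IsMaynardAdmissible`) as soon as `g` is locally bounded measurable and bounded away from `0` near
`t = 0` — in particular for Polymath's profile `g(t) = 1/(c + (k−1)t) · 1_{[0,T]}` of Theorem 6.7
(`polymathProfile`, `isMaynardAdmissible_productTestFn_polymathProfile`).

Method: `I`/`J^{(m)}` of a cut-off function (`MaynardTao.maynardI_indicator_eq`,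
`MaynardTao.maynardJ_indicator_eq`, Maynard 2015 (7.3)); the simplex integral of
`Φ(∑ tᵢ) ∏ φ(tᵢ)` is sliced along `∑ tᵢ = w` (`FordMaynard.integral_eq_integral_sliceIntegral`) and
each slice integral of a product is a convolution power (`FordMaynard.sliceIntegral_prod_eq_cpow`).
Everything here is proved; no named facts. Deliberately NOT here: the probabilistic normalisation
by `m₂` (a division of both sides), Theorem 6.7 itself and its Chebyshev-type tail estimates.

## References

* D.H.J. Polymath, *Variants of the Selberg sieve, and bounded intervals containing many primes*,
  Res. Math. Sci. 1 (2014), Art. 12, doi:10.1186/s40687-014-0012-7 = arXiv:1407.4897, §6, proof of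
  Theorem 6.7. [cite: Polymath8b2014]
* J. Maynard, *Small gaps between primes*, Ann. of Math. (2) 181 (2015), 383–413, §7 (7.3) and
  §8 (a product test function `∏ g(k tᵢ) · 1_{R_k}` of the same shape). [cite: MaynardAnnals2015]
-/

noncomputable section

open MeasureTheory Set Filter intervalIntegral
open Literature.Analysis.Convolution

namespace Literature.NumberTheory.Sieve

namespace MaynardTao

/-! ### The product test function and its `I`, `J^{(m)}` -/

/-- Polymath's symmetric product test function `F(t) = 1_{R_k}(t) · g(t₁) ⋯ g(t_k)` built from a
one-variable profile `g` (proof of Theorem 6.7, with `r = 1`; `R_k = {tᵢ ≥ 0, ∑ tᵢ ≤ 1}` is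
`maynardSimplex k`). [cite: Polymath8b2014, §6, proof of Theorem 6.7 (definition of F)] -/
def productTestFn (k : ℕ) (g : ℝ → ℝ) : (Fin k → ℝ) → ℝ :=
  (maynardSimplex k).indicator fun t => ∏ i, g (t i)

/-- Unfolding `productTestFn`. [cite: Polymath8b2014, §6, proof of Theorem 6.7 (definition of F)] -/
theorem productTestFn_def (k : ℕ) (g : ℝ → ℝ) :
    productTestFn k g = (maynardSimplex k).indicator (fun t => ∏ i, g (t i)) := rfl

/-- `I(F) = ∫_{R_k} ∏ g(tᵢ)²` for the product test function (the first display for `I(F)` in the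
proof of Theorem 6.7, before its probabilistic reading). [cite: Polymath8b2014, §6, proof of Theorem 6.7 (I(F))] -/
theorem maynardI_productTestFn (k : ℕ) (g : ℝ → ℝ) :
    maynardI k (productTestFn k g) = ∫ t in maynardSimplex k, ∏ i, g (t i) ^ 2 := by
  rw [productTestFn, maynardI_indicator_eq]
  refine setIntegral_congr_fun (measurableSet_maynardSimplex k) fun t _ => ?_
  simp only [Finset.prod_pow]

/-- `J^{(m)}(F) = ∫_{R_{k−1}} (∏ g(sᵢ))² (∫₀^{1 − ∑ sᵢ} g)² ds` for the product test function, for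
EVERY coordinate `m` (the display for `J_k(F)` in the proof of Theorem 6.7 together with "by
symmetry `J_i(F) = J_k(F)`"; here `k = n + 1`). [cite: Polymath8b2014, §6, proof of Theorem 6.7 (J_k(F))] -/
theorem maynardJ_productTestFn (n : ℕ) (m : Fin (n + 1)) (g : ℝ → ℝ) :
    maynardJ (n + 1) m (productTestFn (n + 1) g) =
      ∫ s in maynardSimplex n, (∫ u in (0:ℝ)..(1 - ∑ i, s i), g u) ^ 2 * ∏ i, g (s i) ^ 2 := by
  rw [productTestFn, maynardJ_indicator_eq]
  refine setIntegral_congr_fun (measurableSet_maynardSimplex n) fun s _ => ?_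
  have hprod : ∀ u : ℝ, (∏ i, g ((Fin.insertNth m u s : Fin (n + 1) → ℝ) i)) = g u * ∏ i, g (s i) := by
    intro u
    rw [Fin.prod_univ_succAbove _ m]
    simp only [Fin.insertNth_apply_same, Fin.insertNth_apply_succAbove]
  simp_rw [hprod]
  rw [intervalIntegral.integral_mul_const, mul_pow, Finset.prod_pow]

/-- The `J^{(m)}(F)` of the product test function do not depend on `m` ("by symmetry
`J_i(F) = J_k(F)`"). [cite: Polymath8b2014, §6, proof of Theorem 6.7 (J_i(F) = J_k(F))] -/
theorem maynardJ_productTestFn_eq (n : ℕ) (m m' : Fin (n + 1)) (g : ℝ → ℝ) :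
    maynardJ (n + 1) m (productTestFn (n + 1) g) = maynardJ (n + 1) m' (productTestFn (n + 1) g) := by
  rw [maynardJ_productTestFn, maynardJ_productTestFn]

/-! ### Simplex integrals of `Φ(∑ tᵢ) ∏ φ(tᵢ)` are one-dimensional convolution integrals -/

/-- The open positive part of the simplex, `{tᵢ > 0, ∑ tᵢ ≤ 1}`: it differs from `R_k` by the null
set `⋃ᵢ {tᵢ = 0}`. [folklore] -/
private def openSimplex (k : ℕ) : Set (Fin k → ℝ) := {t | (∀ i, 0 < t i) ∧ ∑ i, t i ≤ 1}

/-- The open positive part of the simplex is measurable. [folklore] -/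
private theorem measurableSet_openSimplex (k : ℕ) : MeasurableSet (openSimplex k) := by
  have h1 : MeasurableSet {t : Fin k → ℝ | ∀ i, 0 < t i} := by
    have : {t : Fin k → ℝ | ∀ i, 0 < t i} = ⋂ i, (fun t => t i) ⁻¹' Ioi 0 := by
      ext t; simp
    rw [this]
    exact MeasurableSet.iInter fun i => measurableSet_Ioi.preimage (measurable_pi_apply i)
  have h2 : MeasurableSet {t : Fin k → ℝ | ∑ i, t i ≤ 1} :=
    measurableSet_le (Finset.measurable_sum _ fun i _ => measurable_pi_apply i) measurable_const
  simpa [openSimplex, Set.setOf_and] using h1.inter h2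

/-- The open positive part of the simplex lies in `R_k`. [folklore] -/
private theorem openSimplex_subset (k : ℕ) : openSimplex k ⊆ maynardSimplex k :=
  fun _ ht => ⟨fun i => (ht.1 i).le, ht.2⟩

/-- `R_k` and its open positive part agree almost everywhere. [folklore] -/
private theorem openSimplex_ae_eq (k : ℕ) :
    (openSimplex k : Set (Fin k → ℝ)) =ᵐ[volume] maynardSimplex k := by
  have hae : ∀ᵐ t : Fin k → ℝ ∂volume, ∀ i, t i ≠ 0 := by
    rw [ae_all_iff]
    intro i
    rw [volume_pi]
    exact Measure.ae_eval_ne (fun _ : Fin k => (volume : Measure ℝ)) i 0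
  refine (ae_eq_set).2 ⟨?_, ?_⟩
  · exact measure_mono_null (fun t ht => (ht.2 (openSimplex_subset k ht.1)).elim) measure_empty
  · refine measure_mono_null (fun t ht => ?_) (ae_iff.1 hae)
    simp only [Set.mem_setOf_eq, not_forall, not_not]
    obtain ⟨⟨h0, hsum⟩, hnot⟩ := ht
    by_contra h
    push Not at h
    exact hnot ⟨fun i => lt_of_le_of_ne (h0 i) (fun e => h i e.symm), hsum⟩

/-- Squares of locally bounded measurable functions are locally bounded measurable. [folklore] -/
private theorem locBdd_sq {g : ℝ → ℝ} (hg : LocBdd g) : LocBdd (fun t => g t ^ 2) := by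
  simpa [pow_two] using hg.mul hg

/-- **The law of `S_j = X₁ + ⋯ + X_j` is the `j`-fold convolution power.** For `φ` locally bounded
measurable and `Φ` measurable and bounded on `[0,1]`,
`∫_{R_{n+1}} Φ(∑ tᵢ) ∏ φ(tᵢ) dt = ∫_{(0,1]} Φ(w) φ^{⋆(n+1)}(w) dw` — the identity behind
"`I(F) = m₂^k P(X₁ + ⋯ + X_k ≤ r)`" and "`J_k(F) = m₂^{k−1} E(∫_{[0,r−S_{k−1}]} g)²`" in the proof of
Theorem 6.7 (there phrased with i.i.d. `Xᵢ` of density `g²/m₂`). Proof: slice along `∑ tᵢ = w`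
(`FordMaynard.integral_eq_integral_sliceIntegral`) and evaluate the slice integral of the product
(`FordMaynard.sliceIntegral_prod_eq_cpow`). [cite: Polymath8b2014, §6, proof of Theorem 6.7 (I(F) = m_2^k P(X_1+…+X_k ≤ r))] -/
theorem setIntegral_simplex_sum_prod_eq_cpow (n : ℕ) {φ : ℝ → ℝ} (hφ : LocBdd φ) {Φ : ℝ → ℝ}
    (hΦm : Measurable Φ) {B : ℝ} (hΦb : ∀ w ∈ Icc (0:ℝ) 1, |Φ w| ≤ B) :
    ∫ t in maynardSimplex (n + 1), Φ (∑ i, t i) * ∏ i, φ (t i) =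
      ∫ w in Ioc (0:ℝ) 1, Φ w * cpow φ (n + 1) w := by
  -- the integrand and its restriction to the open positive simplex
  set H : (Fin (n + 1) → ℝ) → ℝ := fun t => Φ (∑ i, t i) * ∏ i, φ (t i) with hH
  set F : (Fin (n + 1) → ℝ) → ℝ := (openSimplex (n + 1)).indicator H with hF
  have hHm : Measurable H :=
    (hΦm.comp (Finset.measurable_sum _ fun i _ => measurable_pi_apply i)).mul
      (Finset.measurable_prod _ fun i _ => hφ.measurable.comp (measurable_pi_apply i))
  -- a uniform bound for `H` on `R_{n+1}`
  obtain ⟨C, hC0, hC⟩ := hφ.bdd_nonneg 1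
  have hB0 : 0 ≤ B := (abs_nonneg _).trans (hΦb 0 ⟨le_rfl, zero_le_one⟩)
  have hHb : ∀ t ∈ maynardSimplex (n + 1), |H t| ≤ B * C ^ (n + 1) := by
    intro t ht
    have hti : ∀ i, t i ∈ Icc (0:ℝ) 1 := fun i =>
      ⟨ht.1 i, (Finset.single_le_sum (fun j _ => ht.1 j) (Finset.mem_univ i)).trans ht.2⟩
    rw [hH, abs_mul, Finset.abs_prod]
    refine mul_le_mul (hΦb _ ⟨Finset.sum_nonneg fun i _ => ht.1 i, ht.2⟩) ?_
      (Finset.prod_nonneg fun i _ => abs_nonneg _) hB0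
    calc ∏ i, |φ (t i)| ≤ ∏ _i : Fin (n + 1), C :=
          Finset.prod_le_prod (fun i _ => abs_nonneg _) fun i _ =>
            hC _ (by rw [abs_of_nonneg (hti i).1]; exact (hti i).2)
      _ = C ^ (n + 1) := by simp
  -- Step 1: the simplex integral is `∫ F`
  have h1 : ∫ t in maynardSimplex (n + 1), H t = ∫ t, F t := by
    rw [hF, MeasureTheory.integral_indicator (measurableSet_openSimplex _)]
    exact (setIntegral_congr_set (openSimplex_ae_eq (n + 1))).symm
  -- Step 2: `F` is integrable and supported in the open positive orthant
  have hFint : Integrable F := by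
    rw [hF, integrable_indicator_iff (measurableSet_openSimplex _)]
    refine Measure.integrableOn_of_bounded (M := B * C ^ (n + 1)) ?_ hHm.aestronglyMeasurable ?_
    · exact ((measure_mono (openSimplex_subset _)).trans_lt
        (isCompact_maynardSimplex (n + 1)).measure_lt_top).ne
    · rw [ae_restrict_iff' (measurableSet_openSimplex _)]
      exact Eventually.of_forall fun t ht => by
        simpa only [Real.norm_eq_abs] using hHb t (openSimplex_subset _ ht)
  have hsupp : ∀ y, F y ≠ 0 → ∀ i, 0 < y i := by
    intro y hy i
    rw [hF] at hy
    by_contra hneg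
    exact hy (Set.indicator_of_notMem (fun h => hneg (h.1 i)) _)
  -- Step 3: slice along `∑ tᵢ = w`
  obtain ⟨hslice, -⟩ := FordMaynard.integral_eq_integral_sliceIntegral hFint hsupp
  -- Step 4: the slice integrals
  have h4 : ∀ w, FordMaynard.sliceIntegral (n + 1) w F =
      (Ioc (0:ℝ) 1).indicator (fun w => Φ w * cpow φ (n + 1) w) w := by
    intro w
    by_cases hw : w ∈ Ioc (0:ℝ) 1
    · rw [Set.indicator_of_mem hw]
      have hcongr : FordMaynard.sliceIntegral (n + 1) w F =
          FordMaynard.sliceIntegral (n + 1) w (fun u => Φ w * ∏ i, φ (u i)) := by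
        refine FordMaynard.sliceIntegral_congr fun v hv hsum => ?_
        have hmem : v ∈ openSimplex (n + 1) := ⟨hv, by rw [hsum]; exact hw.2⟩
        rw [hF, Set.indicator_of_mem hmem, hH]
        simp only [hsum]
      rw [hcongr, FordMaynard.sliceIntegral_const_mul,
        FordMaynard.sliceIntegral_prod_eq_cpow hφ n hw.1]
    · rw [Set.indicator_of_notMem hw]
      have hcongr : FordMaynard.sliceIntegral (n + 1) w F =
          FordMaynard.sliceIntegral (n + 1) w (fun _ => 0) := by
        refine FordMaynard.sliceIntegral_congr fun v hv hsum => ?_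
        rw [hF]
        refine Set.indicator_of_notMem (fun hmem => hw ?_) _
        refine ⟨?_, by rw [← hsum]; exact hmem.2⟩
        rw [← hsum]
        exact Finset.sum_pos (fun i _ => hv i) Finset.univ_nonempty
      rw [hcongr, FordMaynard.sliceIntegral_zero]
  -- Step 5: assemble
  calc ∫ t in maynardSimplex (n + 1), H t = ∫ t, F t := h1
    _ = ∫ w, FordMaynard.sliceIntegral (n + 1) w F := hslice
    _ = ∫ w, (Ioc (0:ℝ) 1).indicator (fun w => Φ w * cpow φ (n + 1) w) w :=
        integral_congr_ae (Eventually.of_forall h4)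
    _ = ∫ w in Ioc (0:ℝ) 1, Φ w * cpow φ (n + 1) w := MeasureTheory.integral_indicator measurableSet_Ioc

/-! ### `I`, `J`, and the functional of a product test function as convolution integrals -/

/-- **`I(F) = m₂^k P(S_k ≤ 1)` written out**: for `k ≥ 1` and locally bounded measurable `g`,
`I(F) = ∫_{(0,1]} (g²)^{⋆k}(w) dw`. [cite: Polymath8b2014, §6, proof of Theorem 6.7 (I(F) = m_2^k P(X_1+…+X_k ≤ r))] -/
theorem maynardI_productTestFn_eq_cpow {k : ℕ} (hk : 1 ≤ k) {g : ℝ → ℝ} (hg : LocBdd g) :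
    maynardI k (productTestFn k g) = ∫ w in Ioc (0:ℝ) 1, cpow (fun t => g t ^ 2) k w := by
  obtain ⟨n, rfl⟩ : ∃ n, k = n + 1 := ⟨k - 1, by omega⟩
  refine (maynardI_productTestFn (n + 1) g).trans ?_
  have h := setIntegral_simplex_sum_prod_eq_cpow n (locBdd_sq hg) (Φ := fun _ => (1:ℝ)) measurable_const
    (B := 1) (fun w _ => by simp)
  simpa only [one_mul] using h

/-- A locally bounded measurable function is interval-integrable on every interval. [folklore] -/
private theorem locBdd_intervalIntegrable {g : ℝ → ℝ} (hg : LocBdd g) (a b : ℝ) :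
    IntervalIntegrable g volume a b := by
  obtain ⟨C, _, hC⟩ := hg.bdd_nonneg (max |a| |b|)
  refine (intervalIntegrable_const (c := C)).mono_fun' hg.measurable.aestronglyMeasurable ?_
  rw [EventuallyLE, ae_restrict_iff' measurableSet_uIoc]
  refine Eventually.of_forall fun t ht => ?_
  rw [Real.norm_eq_abs]
  refine hC t ?_
  rcases Set.mem_uIoc.1 ht with ⟨h1, h2⟩ | ⟨h1, h2⟩
  · rw [abs_le]
    exact ⟨by linarith [neg_abs_le a, le_max_left |a| |b|],
      by linarith [le_abs_self b, le_max_right |a| |b|]⟩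
  · rw [abs_le]
    exact ⟨by linarith [neg_abs_le b, le_max_right |a| |b|],
      by linarith [le_abs_self a, le_max_left |a| |b|]⟩

/-- The primitive `w ↦ ∫₀^{1−w} g` of a locally bounded measurable `g` is continuous. [folklore] -/
private theorem continuous_primitive_oneSub {g : ℝ → ℝ} (hg : LocBdd g) :
    Continuous fun w : ℝ => ∫ u in (0:ℝ)..(1 - w), g u :=
  (intervalIntegral.continuous_primitive (locBdd_intervalIntegrable hg) 0).comp
    (continuous_const.sub continuous_id)

/-- **`J_k(F) = m₂^{k−1} E(∫_{[0,1−S_{k−1}]} g)²` written out**: for `k = n + 2 ≥ 2`, every `m`,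
and locally bounded measurable `g`, `J^{(m)}(F) = ∫_{(0,1]} (∫₀^{1−w} g)² (g²)^{⋆(k−1)}(w) dw`.
[cite: Polymath8b2014, §6, proof of Theorem 6.7 (J_k(F) = m_2^{k-1} E(…)^2)] -/
theorem maynardJ_productTestFn_eq_cpow (n : ℕ) (m : Fin (n + 2)) {g : ℝ → ℝ} (hg : LocBdd g) :
    maynardJ (n + 2) m (productTestFn (n + 2) g) =
      ∫ w in Ioc (0:ℝ) 1, (∫ u in (0:ℝ)..(1 - w), g u) ^ 2 * cpow (fun t => g t ^ 2) (n + 1) w := by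
  refine (maynardJ_productTestFn (n + 1) m g).trans ?_
  -- `Φ(w) = (∫₀^{1−w} g)²` is continuous, hence measurable and bounded on `[0,1]`
  have hcont : Continuous fun w : ℝ => (∫ u in (0:ℝ)..(1 - w), g u) ^ 2 :=
    (continuous_primitive_oneSub hg).pow 2
  obtain ⟨B, hB⟩ := isCompact_Icc.exists_bound_of_continuousOn (hcont.continuousOn (s := Icc (0:ℝ) 1))
  exact setIntegral_simplex_sum_prod_eq_cpow n (locBdd_sq hg) hcont.measurable (B := B)
    (fun w hw => by simpa only [Real.norm_eq_abs] using hB w hw)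

/-- **The Maynard functional of Polymath's product test function as a ratio of two one-dimensional
convolution integrals** (`k = n + 2 ≥ 2`): combining `I(F) = m₂^k P(S_k ≤ 1)`,
`J_i(F) = J_k(F) = m₂^{k−1} E(∫_{[0,1−S_{k−1}]} g)²` of the proof of Theorem 6.7,
`(∑ₘ J^{(m)}(F)) / I(F) = k · ∫_{(0,1]} (∫₀^{1−w} g)² (g²)^{⋆(k−1)} / ∫_{(0,1]} (g²)^{⋆k}`.
[cite: Polymath8b2014, §6, proof of Theorem 6.7 (I(F), J_k(F), J_i(F) = J_k(F))] -/
theorem maynardFunctional_productTestFn (n : ℕ) {g : ℝ → ℝ} (hg : LocBdd g) :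
    maynardFunctional (n + 2) (productTestFn (n + 2) g) =
      (n + 2 : ℝ) * (∫ w in Ioc (0:ℝ) 1, (∫ u in (0:ℝ)..(1 - w), g u) ^ 2 * cpow (fun t => g t ^ 2) (n + 1) w) /
        ∫ w in Ioc (0:ℝ) 1, cpow (fun t => g t ^ 2) (n + 2) w := by
  rw [maynardFunctional, maynardI_productTestFn_eq_cpow (k := n + 2) (by omega) hg]
  congr 1
  rw [Finset.sum_congr rfl fun m _ => maynardJ_productTestFn_eq_cpow n m hg, Finset.sum_const,
    Finset.card_univ, Fintype.card_fin, nsmul_eq_mul]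
  push_cast
  ring

/-! ### Admissibility -/

/-- A product test function with locally bounded measurable profile and `I(F) > 0` is an admissible
test function for `M_k` (square-integrable class of Polymath 8b §3 / Theorem 3.9 hypothesis;
`F` is bounded and supported on the compact `R_k`). [cite: Polymath8b2014, §6, proof of Theorem 6.7 (F square-integrable, supported on R_k)] -/
theorem isMaynardAdmissible_productTestFn {k : ℕ} {g : ℝ → ℝ} (hg : LocBdd g)
    (hI : 0 < maynardI k (productTestFn k g)) : IsMaynardAdmissible k (productTestFn k g) where
  measurable := (Finset.measurable_prod _ fun i _ => hg.measurable.comp (measurable_pi_apply i)).indicator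
    (measurableSet_maynardSimplex k)
  support_subset := Set.support_indicator_subset
  integrableOn_sq := by
    obtain ⟨C, hC0, hC⟩ := hg.bdd_nonneg 1
    have hm : Measurable fun t : Fin k → ℝ => productTestFn k g t ^ 2 :=
      ((Finset.measurable_prod _ fun i _ => hg.measurable.comp (measurable_pi_apply i)).indicator
        (measurableSet_maynardSimplex k)).pow_const 2
    refine Measure.integrableOn_of_bounded (M := (C ^ k) ^ 2)
      (isCompact_maynardSimplex k).measure_lt_top.ne hm.aestronglyMeasurable ?_
    rw [ae_restrict_iff' (measurableSet_maynardSimplex k)]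
    refine Eventually.of_forall fun t ht => ?_
    have hti : ∀ i, t i ∈ Icc (0:ℝ) 1 := fun i =>
      ⟨ht.1 i, (Finset.single_le_sum (fun j _ => ht.1 j) (Finset.mem_univ i)).trans ht.2⟩
    rw [Real.norm_eq_abs, productTestFn, Set.indicator_of_mem ht, abs_pow, Finset.abs_prod]
    refine pow_le_pow_left₀ (Finset.prod_nonneg fun i _ => abs_nonneg _) ?_ 2
    calc ∏ i, |g (t i)| ≤ ∏ _i : Fin k, C :=
          Finset.prod_le_prod (fun i _ => abs_nonneg _) fun i _ =>
            hC _ (by rw [abs_of_nonneg (hti i).1]; exact (hti i).2)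
      _ = C ^ k := by simp
  maynardI_pos := hI

/-- `I(F) > 0` for a product test function whose profile is bounded away from zero near `0` (the
non-degeneracy `I(F) ≠ 0` that the definition of `M_k`, Polymath 8b Theorem 3.9 / (mk4), asks of a
test function; for Polymath's `F` of the proof of Theorem 6.7 it holds because `g > 0` on `[0,T]`):
if `|g| ≥ δ > 0` on `[0, ε]` (`0 < ε ≤ 1`) then `I(F) ≥ δ^{2k} (ε/(k+1))^k > 0`, because the cube
`[0, ε/(k+1)]^k` lies in `R_k`. [cite: Polymath8b2014, §6, proof of Theorem 6.7 (F square-integrable, supported on R_k, I(F) ≠ 0)] -/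
theorem maynardI_productTestFn_pos {k : ℕ} {g : ℝ → ℝ} (hg : LocBdd g) {δ ε : ℝ} (hδ : 0 < δ)
    (hε : 0 < ε) (hε1 : ε ≤ 1) (hgδ : ∀ t ∈ Icc (0:ℝ) ε, δ ≤ |g t|) :
    0 < maynardI k (productTestFn k g) := by
  rw [maynardI_productTestFn]
  set ε' : ℝ := ε / (k + 1) with hε'
  have hε'0 : 0 < ε' := by positivity
  have hε'ε : ε' ≤ ε := div_le_self hε.le (le_add_of_nonneg_left (Nat.cast_nonneg k))
  -- the small cube `Q = [0, ε']^k ⊆ R_k`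
  set Q : Set (Fin k → ℝ) := Icc (fun _ : Fin k => (0:ℝ)) (fun _ => ε') with hQ
  have hQR : Q ⊆ maynardSimplex k := by
    intro t ht
    rw [hQ, Set.mem_Icc] at ht
    refine ⟨fun i => ht.1 i, ?_⟩
    calc ∑ i, t i ≤ ∑ _i : Fin k, ε' := Finset.sum_le_sum fun i _ => ht.2 i
      _ = k * ε' := by simp
      _ ≤ ε := by
          rw [hε', mul_div_assoc']
          exact (div_le_iff₀ (by positivity)).2 (by nlinarith)
      _ ≤ 1 := hε1
  -- integrability of the (bounded, measurable) integrand on `R_k`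
  obtain ⟨C, hC0, hC⟩ := hg.bdd_nonneg 1
  have hm : Measurable fun t : Fin k → ℝ => ∏ i, g (t i) ^ 2 :=
    Finset.measurable_prod _ fun i _ => (hg.measurable.comp (measurable_pi_apply i)).pow_const 2
  have hint : IntegrableOn (fun t : Fin k → ℝ => ∏ i, g (t i) ^ 2) (maynardSimplex k) := by
    refine Measure.integrableOn_of_bounded (M := (C ^ 2) ^ k)
      (isCompact_maynardSimplex k).measure_lt_top.ne hm.aestronglyMeasurable ?_
    rw [ae_restrict_iff' (measurableSet_maynardSimplex k)]
    refine Eventually.of_forall fun t ht => ?_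
    have hti : ∀ i, t i ∈ Icc (0:ℝ) 1 := fun i =>
      ⟨ht.1 i, (Finset.single_le_sum (fun j _ => ht.1 j) (Finset.mem_univ i)).trans ht.2⟩
    rw [Real.norm_eq_abs, Finset.abs_prod]
    calc ∏ i, |g (t i) ^ 2| ≤ ∏ _i : Fin k, C ^ 2 :=
          Finset.prod_le_prod (fun i _ => abs_nonneg _) fun i _ => by
            rw [abs_pow]
            exact pow_le_pow_left₀ (abs_nonneg _)
              (hC _ (by rw [abs_of_nonneg (hti i).1]; exact (hti i).2)) 2
      _ = (C ^ 2) ^ k := by simp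
  have hnonneg : ∀ t : Fin k → ℝ, 0 ≤ ∏ i, g (t i) ^ 2 :=
    fun t => Finset.prod_nonneg fun i _ => sq_nonneg _
  -- `∫_{R_k} ≥ ∫_Q ≥ δ^{2k} vol(Q)`
  have hvolQ : (volume : Measure (Fin k → ℝ)).real Q = ε' ^ k := by
    rw [measureReal_def, hQ, Real.volume_Icc_pi_toReal (fun _ => hε'0.le)]
    simp
  have hlow : ∫ t in Q, (δ ^ 2) ^ k ≤ ∫ t in Q, ∏ i, g (t i) ^ 2 := by
    refine setIntegral_mono_on (integrableOn_const ?_) (hint.mono_set hQR) measurableSet_Icc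
      fun t ht => ?_
    · exact ((measure_mono hQR).trans_lt (isCompact_maynardSimplex k).measure_lt_top).ne
    · rw [hQ, Set.mem_Icc] at ht
      calc ((δ ^ 2) ^ k : ℝ) = ∏ _i : Fin k, δ ^ 2 := by simp
        _ ≤ ∏ i, g (t i) ^ 2 := Finset.prod_le_prod (fun i _ => by positivity) fun i _ => by
            rw [← sq_abs (g _)]
            exact pow_le_pow_left₀ hδ.le (hgδ _ ⟨ht.1 i, (ht.2 i).trans hε'ε⟩) 2
  calc (0:ℝ) < (δ ^ 2) ^ k * ε' ^ k := by positivity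
    _ = ∫ t in Q, (δ ^ 2) ^ k := by rw [setIntegral_const, hvolQ, smul_eq_mul, mul_comm]
    _ ≤ ∫ t in Q, ∏ i, g (t i) ^ 2 := hlow
    _ ≤ ∫ t in maynardSimplex k, ∏ i, g (t i) ^ 2 :=
        setIntegral_mono_set hint (Eventually.of_forall hnonneg) (Eventually.of_forall hQR)

/-! ### Polymath's profile `g(t) = 1/(c + (k−1)t)` on `[0, T]` -/

/-- The profile of Theorem 6.7: `g(t) = 1/(c + (k−1)t)` for `t ∈ [0,T]`, extended by zero
("`g` is extended by zero to `[0, +∞)`"; here to all of `ℝ`). [cite: Polymath8b2014, Theorem 6.7 (definition of g)] -/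
def polymathProfile (k : ℕ) (c T : ℝ) : ℝ → ℝ :=
  Set.indicator (Set.Icc (0:ℝ) T) fun x => 1 / (c + ((k:ℝ) - 1) * x)

/-- Unfolding `polymathProfile`. [cite: Polymath8b2014, Theorem 6.7 (definition of g)] -/
theorem polymathProfile_def (k : ℕ) (c T : ℝ) :
    polymathProfile k c T = Set.indicator (Set.Icc (0:ℝ) T) (fun x => 1 / (c + ((k:ℝ) - 1) * x)) :=
  rfl

/-- On `[0, T]` (with `c > 0`, `k ≥ 1`) the profile satisfies `1/(c + (k−1)T) ≤ g(t) ≤ 1/c`.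
[cite: Polymath8b2014, Theorem 6.7 (definition of g)] -/
theorem polymathProfile_mem_Icc {k : ℕ} (hk : 1 ≤ k) {c T : ℝ} (hc : 0 < c) (hT : 0 ≤ T) {t : ℝ}
    (ht : t ∈ Icc (0:ℝ) T) :
    polymathProfile k c T t ∈ Icc (1 / (c + ((k:ℝ) - 1) * T)) (1 / c) := by
  have hk' : (0:ℝ) ≤ (k:ℝ) - 1 := by
    have : (1:ℝ) ≤ k := by exact_mod_cast hk
    linarith
  rw [polymathProfile, Set.indicator_of_mem ht]
  have hden : c ≤ c + ((k:ℝ) - 1) * t := by nlinarith [ht.1]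
  have hden' : c + ((k:ℝ) - 1) * t ≤ c + ((k:ℝ) - 1) * T := by nlinarith [ht.2]
  have _ := hT
  exact ⟨one_div_le_one_div_of_le (by linarith) hden', one_div_le_one_div_of_le hc hden⟩

/-- The profile vanishes off `[0, T]`. [cite: Polymath8b2014, Theorem 6.7 (definition of g)] -/
theorem polymathProfile_of_notMem {k : ℕ} {c T t : ℝ} (ht : t ∉ Icc (0:ℝ) T) :
    polymathProfile k c T t = 0 := by
  rw [polymathProfile, Set.indicator_of_notMem ht]

/-- Polymath's profile (with `c > 0`, `k ≥ 1`, `T ≥ 0`) is locally bounded measurable: `0 ≤ g ≤ 1/c`.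
[cite: Polymath8b2014, Theorem 6.7 (definition of g)] -/
theorem locBdd_polymathProfile {k : ℕ} (hk : 1 ≤ k) {c T : ℝ} (hc : 0 < c) (hT : 0 ≤ T) :
    LocBdd (polymathProfile k c T) := by
  refine ⟨?_, fun A => ⟨1 / c, fun t _ => ?_⟩⟩
  · refine Measurable.indicator ?_ measurableSet_Icc
    exact (measurable_const.add (measurable_const.mul measurable_id)).const_div 1
  · by_cases ht : t ∈ Icc (0:ℝ) T
    · have h := polymathProfile_mem_Icc hk hc hT ht
      have h0 : 0 ≤ polymathProfile k c T t := by
        refine le_trans (one_div_pos.2 ?_).le h.1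
        have : (1:ℝ) ≤ k := by exact_mod_cast hk
        nlinarith
      rw [abs_of_nonneg h0]
      exact h.2
    · rw [polymathProfile_of_notMem ht, abs_zero]
      exact (one_div_pos.2 hc).le

/-- **Polymath's product test function is Maynard-admissible**: for `k ≥ 1`, `c > 0`, `T > 0` the
function `F = 1_{R_k} ∏ g(tᵢ)` with `g(t) = 1/(c + (k−1)t) 1_{[0,T]}` is measurable, supported on
`R_k`, square-integrable, with `I(F) > 0` ("`F … is square-integrable and supported on
`[0,T]^k ∩ R_k`" in the proof of Theorem 6.7). [cite: Polymath8b2014, §6, proof of Theorem 6.7 (F square-integrable, supported on R_k)] -/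
theorem isMaynardAdmissible_productTestFn_polymathProfile {k : ℕ} (hk : 1 ≤ k) {c T : ℝ} (hc : 0 < c)
    (hT : 0 < T) : IsMaynardAdmissible k (productTestFn k (polymathProfile k c T)) := by
  have hg := locBdd_polymathProfile hk hc hT.le
  refine isMaynardAdmissible_productTestFn hg ?_
  -- `g ≥ 1/(c + (k−1)T) > 0` on `[0, min T 1]`
  have hk' : (0:ℝ) ≤ (k:ℝ) - 1 := by
    have : (1:ℝ) ≤ k := by exact_mod_cast hk
    linarith
  have hδ : 0 < 1 / (c + ((k:ℝ) - 1) * T) := one_div_pos.2 (by nlinarith)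
  refine maynardI_productTestFn_pos hg hδ (lt_min hT zero_lt_one) (min_le_right _ _) fun t ht => ?_
  have ht' : t ∈ Icc (0:ℝ) T := ⟨ht.1, ht.2.trans (min_le_left _ _)⟩
  have h := polymathProfile_mem_Icc hk hc hT.le ht'
  rw [abs_of_nonneg (hδ.le.trans h.1)]
  exact h.1

/-- The functional of Polymath's product family as a ratio of one-dimensional convolution
integrals, `k = n + 2 ≥ 2`, `c > 0`, `T > 0`: with `g = polymathProfile k c T`,
`(∑ₘ J^{(m)})/I (F) = k ∫_{(0,1]} (∫₀^{1−w} g)² (g²)^{⋆(k−1)} / ∫_{(0,1]} (g²)^{⋆k}` — the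
quantity `k J_k(F)/I(F) = (k/m₂) E(∫_{[0,1−S_{k−1}]} g)² / P(S_k ≤ 1)` of the proof of Theorem 6.7
(at `r = 1`), which bounds `M_k` from below by the definition of `M_k`. [cite: Polymath8b2014, §6, proof of Theorem 6.7 (I(F), J_k(F))] -/
theorem maynardFunctional_productTestFn_polymathProfile (n : ℕ) {c T : ℝ} (hc : 0 < c) (hT : 0 < T) :
    maynardFunctional (n + 2) (productTestFn (n + 2) (polymathProfile (n + 2) c T)) =
      (n + 2 : ℝ) *
          (∫ w in Ioc (0:ℝ) 1, (∫ u in (0:ℝ)..(1 - w), polymathProfile (n + 2) c T u) ^ 2 *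
            cpow (fun t => polymathProfile (n + 2) c T t ^ 2) (n + 1) w) /
        ∫ w in Ioc (0:ℝ) 1, cpow (fun t => polymathProfile (n + 2) c T t ^ 2) (n + 2) w :=
  maynardFunctional_productTestFn n (locBdd_polymathProfile (by omega) hc hT.le)

/-! ### Integrability and non-vacuity of the two convolution integrals

Lean's Bochner integral returns the junk value `0` on a non-integrable integrand, so an upper bound
`∫_{(0,1]} (g²)^{⋆k} ≤ D` taken in isolation would be vacuous for a non-integrable integrand. The
following records, for locally bounded measurable `g` (in particular for Polymath's profile), that BOTH
one-dimensional integrands of `maynardFunctional_productTestFn` — `(g²)^{⋆n}` and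
`w ↦ (∫₀^{1−w} g)² (g²)^{⋆n}(w)` — are integrable on every `(a, b]`, and that the denominator
`∫_{(0,1]} (g²)^{⋆n}` is strictly positive (it is `I(F) > 0` of the proof of Theorem 6.7). -/

/-- A continuous function is locally bounded measurable. [folklore] -/
private theorem locBdd_of_continuous {φ : ℝ → ℝ} (hφ : Continuous φ) : LocBdd φ := by
  refine ⟨hφ.measurable, fun A => ?_⟩
  obtain ⟨C, hC⟩ :=
    (isCompact_Icc (a := -A) (b := A)).exists_bound_of_continuousOn (hφ.continuousOn (s := Icc (-A) A))
  refine ⟨C, fun t ht => ?_⟩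
  rw [← Real.norm_eq_abs]
  exact hC t (mem_Icc.2 (abs_le.1 ht))

/-- **The denominator integrand is integrable**: for locally bounded measurable `g`, the convolution
power `(g²)^{⋆n}` is integrable on every `(a, b]` (so `∫_{(0,1]} (g²)^{⋆k} = I(F)/1` is a genuine
Lebesgue integral, not a junk value). [cite: Polymath8b2014, §6, proof of Theorem 6.7 (I(F) = m_2^k P(X_1+…+X_k ≤ r))] -/
theorem integrableOn_cpow_sq {g : ℝ → ℝ} (hg : LocBdd g) (n : ℕ) (a b : ℝ) :
    IntegrableOn (cpow (fun t => g t ^ 2) n) (Ioc a b) :=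
  ((locBdd_sq hg).cpow n).integrableOn_Ioc a b

/-- **The numerator integrand is integrable**: for locally bounded measurable `g`,
`w ↦ (∫₀^{1−w} g)² · (g²)^{⋆n}(w)` is integrable on every `(a, b]` (the primitive is continuous, hence
locally bounded). [cite: Polymath8b2014, §6, proof of Theorem 6.7 (J_k(F) = m_2^{k-1} E(…)^2)] -/
theorem integrableOn_primitiveSq_mul_cpow_sq {g : ℝ → ℝ} (hg : LocBdd g) (n : ℕ) (a b : ℝ) :
    IntegrableOn (fun w => (∫ u in (0:ℝ)..(1 - w), g u) ^ 2 * cpow (fun t => g t ^ 2) n w)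
      (Ioc a b) :=
  ((locBdd_of_continuous ((continuous_primitive_oneSub hg).pow 2)).mul
    ((locBdd_sq hg).cpow n)).integrableOn_Ioc a b

/-- **The denominator is positive**: if `|g| ≥ δ > 0` on `[0, ε]` (`0 < ε ≤ 1`) then
`∫_{(0,1]} (g²)^{⋆n} > 0` for every `n ≥ 1` (this is `I(F) > 0` for the product test function with
`n` factors, via `maynardI_productTestFn_eq_cpow`). [cite: Polymath8b2014, §6, proof of Theorem 6.7 (F square-integrable, supported on R_k, I(F) ≠ 0)] -/
theorem setIntegral_cpow_sq_pos {n : ℕ} (hn : 1 ≤ n) {g : ℝ → ℝ} (hg : LocBdd g) {δ ε : ℝ}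
    (hδ : 0 < δ) (hε : 0 < ε) (hε1 : ε ≤ 1) (hgδ : ∀ t ∈ Icc (0:ℝ) ε, δ ≤ |g t|) :
    0 < ∫ w in Ioc (0:ℝ) 1, cpow (fun t => g t ^ 2) n w := by
  rw [← maynardI_productTestFn_eq_cpow hn hg]
  exact maynardI_productTestFn_pos hg hδ hε hε1 hgδ

/-- Integrability of the denominator integrand for Polymath's profile `g = polymathProfile k c T`
(`k ≥ 1`, `c > 0`, `T ≥ 0`), any number `n` of convolution factors, every `(a, b]`.
[cite: Polymath8b2014, §6, proof of Theorem 6.7 (I(F) = m_2^k P(X_1+…+X_k ≤ r))] -/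
theorem integrableOn_cpow_polymathProfile_sq {k : ℕ} (hk : 1 ≤ k) {c T : ℝ} (hc : 0 < c)
    (hT : 0 ≤ T) (n : ℕ) (a b : ℝ) :
    IntegrableOn (cpow (fun t => polymathProfile k c T t ^ 2) n) (Ioc a b) :=
  integrableOn_cpow_sq (locBdd_polymathProfile hk hc hT) n a b

/-- Integrability of the numerator integrand for Polymath's profile `g = polymathProfile k c T`
(`k ≥ 1`, `c > 0`, `T ≥ 0`), any `n`, every `(a, b]`.
[cite: Polymath8b2014, §6, proof of Theorem 6.7 (J_k(F) = m_2^{k-1} E(…)^2)] -/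
theorem integrableOn_primitiveSq_mul_cpow_polymathProfile_sq {k : ℕ} (hk : 1 ≤ k) {c T : ℝ}
    (hc : 0 < c) (hT : 0 ≤ T) (n : ℕ) (a b : ℝ) :
    IntegrableOn (fun w => (∫ u in (0:ℝ)..(1 - w), polymathProfile k c T u) ^ 2 *
      cpow (fun t => polymathProfile k c T t ^ 2) n w) (Ioc a b) :=
  integrableOn_primitiveSq_mul_cpow_sq (locBdd_polymathProfile hk hc hT) n a b

/-- **Positivity of the denominator for Polymath's profile**: for `k ≥ 1`, `c > 0`, `T > 0` and every
`n ≥ 1`, `∫_{(0,1]} (g²)^{⋆n} > 0` with `g = polymathProfile k c T` (since `g ≥ 1/(c + (k−1)T) > 0`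
on `[0, min T 1]`). [cite: Polymath8b2014, §6, proof of Theorem 6.7 (F square-integrable, supported on R_k, I(F) ≠ 0)] -/
theorem setIntegral_cpow_polymathProfile_sq_pos {k : ℕ} (hk : 1 ≤ k) {c T : ℝ} (hc : 0 < c)
    (hT : 0 < T) {n : ℕ} (hn : 1 ≤ n) :
    0 < ∫ w in Ioc (0:ℝ) 1, cpow (fun t => polymathProfile k c T t ^ 2) n w := by
  have hg := locBdd_polymathProfile hk hc hT.le
  have hk' : (0:ℝ) ≤ (k:ℝ) - 1 := by
    have : (1:ℝ) ≤ k := by exact_mod_cast hk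
    linarith
  have hδ : 0 < 1 / (c + ((k:ℝ) - 1) * T) := one_div_pos.2 (by nlinarith)
  refine setIntegral_cpow_sq_pos hn hg hδ (lt_min hT zero_lt_one) (min_le_right _ _) fun t ht => ?_
  have ht' : t ∈ Icc (0:ℝ) T := ⟨ht.1, ht.2.trans (min_le_left _ _)⟩
  have h := polymathProfile_mem_Icc hk hc hT.le ht'
  rw [abs_of_nonneg (hδ.le.trans h.1)]
  exact h.1

end MaynardTao

end Literature.NumberTheory.Sieve
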